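import Literature.Computability.QuantumComplexity.HybridArgument
import HarnessLib

/-!
# Query magnitudes as measurement probabilities of TRUNCATED runs

Topic `Literature/Computability/QuantumComplexity`; companion of `HybridArgument.lean` (BBBV's query magnitudes
`queryWeights A D gs ψ`: the list, over the oracle gates of the gate list `gs` run from `ψ` under the oracle `A`, of
`q_D(|φ_t⟩)`, the squared amplitude of the basis states whose query register spells a string of `D` in the state
`|φ_t⟩` just before the `t`-th query; Bennett–Bernstein–Brassard–Vazirani 1997, Def. 3.2). The definition is a
recursion threading the state; to ESTIMATE a query magnitude on a quantum computer one runs the TRUNCATED circuit — the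
gates before the `t`-th oracle gate — and measures the query register of that gate (BBBV 1997, proof of Thm. 3.5 /
Cor. 3.4: "run the machine … until just before the `i`-th query and measure the query tape"). This file makes the
truncations explicit:

* `oraclePositions gs` — the list, over the oracle gates of `gs` in order, of (the PREFIX of `gs` before the gate,
  its number of query wires `k`, its wire embedding `e`); `length_oraclePositions` (= `oracleQueries`),
  `oraclePositions_prefix` (every prefix is `gs.take i` for some `i`), `oraclePositions_mem` (the gate follows its prefix);
* **`queryWeights_eq_map_oraclePositions`** — `queryWeights A D gs ψ` is, entry by entry, the query magnitude
  `queryWeight D e (U_{prefix}^A ψ)` of the state obtained by running the prefix: the `t`-th BBBV magnitude is the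
  probability that measuring the query register of the `t`-th oracle gate after the truncated run yields a string of `D`.

Everything here is PROVED; one definition (`oraclePositions`).

## References

* C. H. Bennett, E. Bernstein, G. Brassard, U. Vazirani, *Strengths and weaknesses of quantum computing*, SIAM J.
  Comput. 26 (1997) 1510–1523, Def. 3.2 (query magnitude), Thm. 3.3 / 3.5 (proofs: the state before the `i`-th query)
  [BennettBernsteinBrassardVazirani1997].
* M. A. Nielsen, I. L. Chuang, *Quantum Computation and Quantum Information*, CUP 2010, §2.2.5 (Born rule), §6.1.1
  [NielsenChuang2010].
-/

noncomputable section

namespace Literature.Computability.QuantumComplexity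

open Cryptography Matrix

variable {G : QGateSet} {N : ℕ}

/-- **The oracle positions of a gate list**: for each oracle gate of `gs`, in order, the prefix of `gs` strictly before
it, its number `k` of query wires and its wires `e : Fin (k+1) ↪ Fin N`.
[cite: BennettBernsteinBrassardVazirani1997, Thm. 3.3 (proof: the configuration before the i-th query)] -/
def oraclePositions : List (QGate G N) → List (List (QGate G N) × Σ k : ℕ, (Fin (k + 1) ↪ Fin N))
  | [] => []
  | (.gate g e) :: gs => (oraclePositions gs).map fun q => (QGate.gate g e :: q.1, q.2)
  | (.oracle k e) :: gs => ([], ⟨k, e⟩) :: (oraclePositions gs).map fun q => (QGate.oracle k e :: q.1, q.2)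

/-- There is one oracle position per oracle gate. [cite: BennettBernsteinBrassardVazirani1997, Def. 3.2] -/
theorem length_oraclePositions : ∀ gs : List (QGate G N),
    (oraclePositions gs).length = (⟨gs⟩ : QCircuit G N).oracleQueries
  | [] => rfl
  | (.gate g e) :: gs => by
    have ih := length_oraclePositions gs
    unfold QCircuit.oracleQueries at ih ⊢
    rw [oraclePositions, List.length_map, ih, List.filter_cons_of_neg (by simp [QGate.IsOracleFree])]
  | (.oracle k e) :: gs => by
    have ih := length_oraclePositions gs
    unfold QCircuit.oracleQueries at ih ⊢
    rw [oraclePositions, List.length_cons, List.length_map, ih,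
      List.filter_cons_of_pos (by simp [QGate.IsOracleFree]), List.length_cons]

/-- Every prefix recorded in `oraclePositions gs` is an initial segment `gs.take i` of `gs`, followed in `gs` by the
recorded oracle gate. [cite: BennettBernsteinBrassardVazirani1997, Thm. 3.3 (proof)] -/
theorem oraclePositions_prefix : ∀ (gs : List (QGate G N)) (q : List (QGate G N) × Σ k : ℕ, (Fin (k + 1) ↪ Fin N)),
    q ∈ oraclePositions gs → ∃ i, q.1 = gs.take i ∧ gs[i]? = some (QGate.oracle q.2.1 q.2.2)
  | [], q, hq => by simp [oraclePositions] at hq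
  | (.gate g e) :: gs, q, hq => by
    rw [oraclePositions, List.mem_map] at hq
    obtain ⟨q', hq', rfl⟩ := hq
    obtain ⟨i, h1, h2⟩ := oraclePositions_prefix gs q' hq'
    exact ⟨i + 1, by simp [h1], by simpa using h2⟩
  | (.oracle k e) :: gs, q, hq => by
    rw [oraclePositions, List.mem_cons, List.mem_map] at hq
    rcases hq with rfl | ⟨q', hq', rfl⟩
    · exact ⟨0, by simp, by simp⟩
    · obtain ⟨i, h1, h2⟩ := oraclePositions_prefix gs q' hq'
      exact ⟨i + 1, by simp [h1], by simpa using h2⟩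

/-- **BBBV's query magnitudes are measurement probabilities of truncated runs.** For every oracle `A`, set of
strings `D`, gate list `gs` and initial state `ψ`: the list `queryWeights A D gs ψ` equals, position by position, the
query magnitude `queryWeight D e (U^A_{prefix} ψ)` of `D` at the oracle gate's wires `e` in the state reached by running
the prefix of `gs` before that gate.
[cite: BennettBernsteinBrassardVazirani1997, Def. 3.2 and Thm. 3.3 (proof: |φ_i⟩ is the state before the i-th query)] -/
theorem queryWeights_eq_map_oraclePositions (A : Language Bool) (D : Set (List Bool)) :
    ∀ (gs : List (QGate G N)) (ψ : QReg N → ℂ),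
      queryWeights A D gs ψ =
        (oraclePositions gs).map fun q => queryWeight D q.2.2 ((⟨q.1⟩ : QCircuit G N).toMatrix A *ᵥ ψ)
  | [], ψ => by simp [queryWeights, oraclePositions]
  | (.gate g e) :: gs, ψ => by
    rw [queryWeights, queryWeights_eq_map_oraclePositions A D gs, oraclePositions, List.map_map]
    simp only [QGate.queryWeights, List.nil_append]
    refine List.map_congr_left fun q _ => ?_
    simp only [Function.comp_apply, QCircuit.toMatrix_cons, ← Matrix.mulVec_mulVec]
  | (.oracle k e) :: gs, ψ => by
    rw [queryWeights, queryWeights_eq_map_oraclePositions A D gs, oraclePositions, List.map_cons, List.map_map]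
    simp only [QGate.queryWeights, List.singleton_append, QCircuit.toMatrix_nil, Matrix.one_mulVec]
    congr 1
    refine List.map_congr_left fun q _ => ?_
    simp only [Function.comp_apply, QCircuit.toMatrix_cons, ← Matrix.mulVec_mulVec]

/-- **The `t`-th query magnitude, as a truncated-run probability.** [cite: BennettBernsteinBrassardVazirani1997, Def. 3.2] -/
theorem queryWeights_getElem (A : Language Bool) (D : Set (List Bool)) (gs : List (QGate G N)) (ψ : QReg N → ℂ)
    (t : ℕ) (ht : t < (oraclePositions gs).length) :
    (queryWeights A D gs ψ)[t]'(by rw [queryWeights_eq_map_oraclePositions, List.length_map]; exact ht) =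
      queryWeight D ((oraclePositions gs)[t]).2.2 ((⟨((oraclePositions gs)[t]).1⟩ : QCircuit G N).toMatrix A *ᵥ ψ) := by
  simp only [queryWeights_eq_map_oraclePositions, List.getElem_map]

/-- **The total query magnitude of `D` along the run is the sum of the truncated-run probabilities.**
[cite: BennettBernsteinBrassardVazirani1997, Cor. 3.4 (proof: Σ_i q_y(|φ_i⟩))] -/
theorem sum_queryWeights_eq_sum_oraclePositions (A : Language Bool) (D : Set (List Bool)) (gs : List (QGate G N))
    (ψ : QReg N → ℂ) :
    (queryWeights A D gs ψ).sum =
      ((oraclePositions gs).map fun q => queryWeight D q.2.2 ((⟨q.1⟩ : QCircuit G N).toMatrix A *ᵥ ψ)).sum := by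
  rw [queryWeights_eq_map_oraclePositions]

end Literature.Computability.QuantumComplexity

end
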